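import Mathlib.NumberTheory.Padics.Hensel
import Mathlib.NumberTheory.Padics.RingHoms
import Mathlib.Tactic

/-!
# Elementary 2-adic facts for the Moser-field theorem (cell `pub-namedobj`, target (U), seat udg g10)

Framing (verbatim for the cell): lottery ticket; floor = certified bounds/negative ranges.

* `exists_sq_eq_thirtyThree` — `33` is a square in `ℚ₂` (Hensel);
* `sq_ne_three`, `sq_ne_neg_one`, `sq_ne_neg_three` — `3, -1, -3` are not squares in `ℚ₂` (squares mod `8`);
* `norm_le_one_of_sum_sq` — if `‖a‖, ‖b‖ ≤ 2` and `‖a² + b²‖ ≤ 1` then `‖a‖, ‖b‖ ≤ 1` (sums of two odd squares are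
  `2 mod 4`);
* `exists_rep_zero_one` — every `2`-adic integer is congruent to `0` or `1` modulo the maximal ideal.

All by reduction modulo `4` / `8` in `ℤ₂` (`PadicInt.toZModPow`) and `decide`; nothing here is literature.
-/

namespace Summit.Ventures.DiscreteObjects.UnitDistance.TwoAdic

open PadicInt Polynomial

/-- `33` is a `2`-adic square (Hensel's lemma at `a = 1`: `‖1 - 33‖ = 2⁻⁵ < ‖2‖² = 2⁻²`). -/
theorem exists_sq_eq_thirtyThree : ∃ s : ℚ_[2], s ^ 2 = 33 := by
  set F : Polynomial ℤ := X ^ 2 - C 33 with hF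
  have hFa : F.aeval (1 : ℤ_[2]) = -(2 ^ 5) := by
    simp only [hF, map_sub, map_pow, aeval_X, aeval_C, algebraMap_int_eq, Int.coe_castRingHom, Int.cast_ofNat]
    norm_num
  have hF' : (Polynomial.derivative F).aeval (1 : ℤ_[2]) = 2 := by
    simp only [hF, derivative_sub, derivative_X_pow, derivative_C, sub_zero, map_mul, map_pow, aeval_X,
      map_natCast]
    norm_num
  have hnorm : ‖F.aeval (1 : ℤ_[2])‖ < ‖(Polynomial.derivative F).aeval (1 : ℤ_[2])‖ ^ 2 := by
    have norm_two_int : ‖(2 : ℤ_[2])‖ = 2⁻¹ := by simpa using PadicInt.norm_p (p := 2)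
    rw [hFa, hF', norm_neg, norm_two_int]
    have h5 : ‖(2 : ℤ_[2]) ^ 5‖ = (2 : ℝ) ^ (-5 : ℤ) := by
      have := PadicInt.norm_p_pow (p := 2) 5
      simpa using this
    rw [h5]
    norm_num
  obtain ⟨z, hz, -⟩ := hensels_lemma hnorm
  refine ⟨(z : ℚ_[2]), ?_⟩
  have hz' : z ^ 2 - 33 = 0 := by
    have : F.aeval z = z ^ 2 - 33 := by
      simp only [hF, map_sub, map_pow, aeval_X, aeval_C, algebraMap_int_eq, Int.coe_castRingHom, Int.cast_ofNat]
    rw [← this]; exact hz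
  have hz2 : z ^ 2 = 33 := sub_eq_zero.1 hz'
  have h33 : ((33 : ℤ_[2]) : ℚ_[2]) = 33 := by
    have := PadicInt.coe_natCast (p := 2) 33
    simpa using this
  rw [← PadicInt.coe_pow, hz2, h33]

/-- No `2`-adic number squares to `3`, `-1` or `-3` (reduce modulo `8`). -/
theorem sq_ne_of_mod_eight (a : ℚ_[2]) {c : ℤ} (hc : c = 3 ∨ c = -1 ∨ c = -3) : a ^ 2 ≠ (c : ℚ_[2]) := by
  intro h
  have hcodd : ¬ (2 : ℤ) ∣ c := by rcases hc with rfl | rfl | rfl <;> decide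
  have hcn : ‖(c : ℚ_[2])‖ = 1 := by
    apply le_antisymm (Padic.norm_int_le_one c)
    by_contra hlt
    push Not at hlt
    exact hcodd (Padic.norm_intCast_lt_one_iff.1 hlt)
  have han : ‖a‖ = 1 := by
    have h2 : ‖a‖ ^ 2 = 1 := by rw [← norm_pow, h, hcn]
    have h0 : 0 ≤ ‖a‖ := norm_nonneg a
    nlinarith [h2, h0]
  set z : ℤ_[2] := ⟨a, han.le⟩ with hz
  have hz2 : z ^ 2 = (c : ℤ_[2]) := by
    apply Subtype.ext
    simp [hz, h]
  have h8 := congrArg (toZModPow 3) hz2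
  rw [map_pow, map_intCast] at h8
  have key : ∀ x : ZMod (2 ^ 3), x ^ 2 ≠ 3 ∧ x ^ 2 ≠ -1 ∧ x ^ 2 ≠ -3 := by decide
  rcases hc with rfl | rfl | rfl
  · exact (key _).1 (by simpa using h8)
  · exact (key _).2.1 (by simpa using h8)
  · exact (key _).2.2 (by simpa using h8)

/-- `3` is not a square in `ℚ₂`. -/
theorem sq_ne_three (a : ℚ_[2]) : a ^ 2 ≠ 3 := by
  have := sq_ne_of_mod_eight a (c := 3) (Or.inl rfl)
  simpa using this

/-- `-1` is not a square in `ℚ₂`. -/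
theorem sq_ne_neg_one (a : ℚ_[2]) : a ^ 2 ≠ -1 := by
  have := sq_ne_of_mod_eight a (c := -1) (Or.inr (Or.inl rfl))
  simpa using this

/-- `-3` is not a square in `ℚ₂`. -/
theorem sq_ne_neg_three (a : ℚ_[2]) : a ^ 2 ≠ -3 := by
  have := sq_ne_of_mod_eight a (c := -3) (Or.inr (Or.inr rfl))
  simpa using this

/-- A `2`-adic integer of norm `≤ 2⁻¹` after doubling: if `‖2a‖ ≤ 1`, i.e. `‖a‖ ≤ 2`. Key lemma: if `‖a‖, ‖b‖ ≤ 2` and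
`‖a² + b²‖ ≤ 1` then `‖a‖ ≤ 1` and `‖b‖ ≤ 1` — because `x² + y² ≡ 0 (mod 4)` forces `x, y` even. -/
theorem norm_le_one_of_sum_sq (a b : ℚ_[2]) (ha : ‖a‖ ≤ 2) (hb : ‖b‖ ≤ 2) (h : ‖a ^ 2 + b ^ 2‖ ≤ 1) :
    ‖a‖ ≤ 1 ∧ ‖b‖ ≤ 1 := by
  have h2 : ‖(2 : ℚ_[2])‖ = 2⁻¹ := by simpa using Padic.norm_p (p := 2)
  have ha' : ‖2 * a‖ ≤ 1 := by
    rw [norm_mul, h2]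
    calc 2⁻¹ * ‖a‖ ≤ 2⁻¹ * 2 := by gcongr
      _ = 1 := by norm_num
  have hb' : ‖2 * b‖ ≤ 1 := by
    rw [norm_mul, h2]
    calc 2⁻¹ * ‖b‖ ≤ 2⁻¹ * 2 := by gcongr
      _ = 1 := by norm_num
  set za : ℤ_[2] := ⟨2 * a, ha'⟩ with hza
  set zb : ℤ_[2] := ⟨2 * b, hb'⟩ with hzb
  have hsum : ‖za ^ 2 + zb ^ 2‖ ≤ (2 : ℝ) ^ (-2 : ℤ) := by
    rw [PadicInt.norm_def]
    have : ((za ^ 2 + zb ^ 2 : ℤ_[2]) : ℚ_[2]) = 2 ^ 2 * (a ^ 2 + b ^ 2) := by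
      simp [hza, hzb]; ring
    rw [this, norm_mul, norm_pow, h2]
    calc (2⁻¹ : ℝ) ^ 2 * ‖a ^ 2 + b ^ 2‖ ≤ (2⁻¹ : ℝ) ^ 2 * 1 := by gcongr
      _ = (2 : ℝ) ^ (-2 : ℤ) := by norm_num
  have hmem : za ^ 2 + zb ^ 2 ∈ (Ideal.span {(2 : ℤ_[2]) ^ 2} : Ideal ℤ_[2]) := by
    have := (PadicInt.norm_le_pow_iff_mem_span_pow (za ^ 2 + zb ^ 2) 2).1
    exact this (by simpa using hsum)
  have hker : toZModPow 2 (za ^ 2 + zb ^ 2) = 0 := by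
    rw [← RingHom.mem_ker, PadicInt.ker_toZModPow]; exact hmem
  rw [map_add, map_pow, map_pow] at hker
  have key : ∀ x y : ZMod (2 ^ 2), x ^ 2 + y ^ 2 = 0 →
      (ZMod.cast x : ZMod (2 ^ 1)) = 0 ∧ (ZMod.cast y : ZMod (2 ^ 1)) = 0 := by decide
  obtain ⟨kx, ky⟩ := key _ _ hker
  rw [PadicInt.cast_toZModPow 1 2 (by norm_num)] at kx ky
  have hxa : ‖za‖ ≤ (2 : ℝ) ^ (-1 : ℤ) := by
    have hm : za ∈ RingHom.ker (toZModPow (p := 2) 1) := by rw [RingHom.mem_ker]; exact kx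
    rw [PadicInt.ker_toZModPow] at hm
    simpa using (PadicInt.norm_le_pow_iff_mem_span_pow za 1).2 hm
  have hxb : ‖zb‖ ≤ (2 : ℝ) ^ (-1 : ℤ) := by
    have hm : zb ∈ RingHom.ker (toZModPow (p := 2) 1) := by rw [RingHom.mem_ker]; exact ky
    rw [PadicInt.ker_toZModPow] at hm
    simpa using (PadicInt.norm_le_pow_iff_mem_span_pow zb 1).2 hm
  rw [PadicInt.norm_def] at hxa hxb
  simp only [hza, hzb, norm_mul, h2] at hxa hxb
  constructor
  · have : (2⁻¹ : ℝ) * ‖a‖ ≤ 2⁻¹ := by simpa using hxa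
    linarith
  · have : (2⁻¹ : ℝ) * ‖b‖ ≤ 2⁻¹ := by simpa using hxb
    linarith

/-- Every `2`-adic integer is within distance `< 1` of `0` or `1`. -/
theorem exists_rep_zero_one (a : ℚ_[2]) (ha : ‖a‖ ≤ 1) :
    ∃ ε : ℚ_[2], (ε = 0 ∨ ε = 1) ∧ ‖a - ε‖ < 1 := by
  set z : ℤ_[2] := ⟨a, ha⟩ with hz
  have hr : PadicInt.zmodRepr z < 2 := PadicInt.zmodRepr_lt_p z
  have hmem : z - (PadicInt.zmodRepr z : ℤ_[2]) ∈ IsLocalRing.maximalIdeal ℤ_[2] := PadicInt.sub_zmodRepr_mem z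
  have hlt : ‖z - (PadicInt.zmodRepr z : ℤ_[2])‖ < 1 := by
    rw [IsLocalRing.mem_maximalIdeal, mem_nonunits_iff] at hmem
    exact PadicInt.mem_nonunits.1 hmem
  refine ⟨(PadicInt.zmodRepr z : ℚ_[2]), ?_, ?_⟩
  · rcases Nat.lt_succ_iff.1 hr |>.eq_or_lt with h1 | h0
    · right; simp [h1]
    · left
      have : PadicInt.zmodRepr z = 0 := by omega
      simp [this]
  · rw [PadicInt.norm_def] at hlt
    simpa [hz] using hlt

end Summit.Ventures.DiscreteObjects.UnitDistance.TwoAdic
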